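import Literature.AlgebraicGeometry.Resolution.BlowupAlgebraQuasiRegularChart
import Literature.AlgebraicGeometry.Resolution.QuasiRegularSequences
import Literature.AlgebraicGeometry.Resolution.PowerSeriesRegularLocal
import Mathlib.RingTheory.Regular.Flat
import HarnessLib

/-!
# The curve centre `(a′, b′, w, g)` of the compound-ODP hypersurface `a′b′ + w·g = 0` in `Λ[a′, b′, w]`: quotient `Λ/(g)`, quasi-regularity, `h ∈ I²`
# (E4″@G T-side (F3-w), part 1 of 3; crux `FInjectiveMacaulayfication` stmt-ResolutionOfSingularities-15315, chain w45a; res-L1-w45a-plan-1 R18.27/R18.32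
# «stub-1 keeps E4″ T-side whole»; typing plan res-L1-w45a-stub-3 g9 `E4-STEP-TYPING.md` §B (F3) route (R-a); seat res-L1-w45a-stub-1 g11)

[OURS · L1 W4.5a] Support file (`--supports stmt-ResolutionOfSingularities-15315 --as helper`); replaces the role of NO printed item; NOT a statement of any
manuscript; def-free; UNCONDITIONAL; pure commutative algebra. AI-written (AI review is weaker than expert review).

SETTING (generic). `Λ` a commutative ring, `g ∈ Λ`, `R = Λ[T₀, T₁, T₂]` (`MvPolynomial (Fin 3) Λ`; `T₀ = a′`, `T₁ = b′`, `T₂ = w`), the CENTRE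
`cen = (T₀, T₁, T₂, C g) : Fin 4 → R`, `I = (cen)`, and the hypersurface `h = T₀T₁ + T₂·C g ∈ I²`. On floor 2 of the E4″ tower (`Λ = k[U, V]`, `g = 1 + U³ + V³`,
char 2) `R/(h)` is the `w`-chart `a′b′ + w(1 + U³ + V³)` of `Bl_𝔪 {ab + w₁³ + w₂³ + w₃³ = 0}` and `V(I)` is its singular locus, the smooth cubic curve `E`
(res-L1-w45a-stub-2 `E4GermPointBlowupFull`, chart `g₂`).
* §1 `span_range_cen_eq` — `I = (T₀, T₁, T₂) + g·R` («variables + constants», `BlowupAlgebraQuasiRegularChart` §2); `exists_ringEquiv_quotient` — `R/I ≃+* Λ/(g)` with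
  `C λ ↦ λ̄`; hence `isDomain_quotient`, `isRegularRing_quotient`, `span_range_cen_ne_top` (transfer from `Λ/(g)`).
* §2 `isWeaklyRegular_cen` — `T₀, T₁, T₂, C g` is an `R`-sequence as soon as `g` is a non-zero-divisor of `Λ` (variables: `MvPolynomialKillVars.isWeaklyRegular_map_X`; then
  `C g` acts on `R/(T) ≅ Λ` as `g`); `isQuasiRegular_cen` (Rees, `isQuasiRegular_of_isWeaklyRegular`).
* §3 `h_mem_sq` — `h ∈ I²`; `h_eq_odp` — `h = cen 0 · cen 1 + cen 2 · cen 3` (the ODP family of `StrictTransformGraphType` §4 at `(p,p′,q,q′) = (0,1,2,3)`) and its three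
  reorderings; `not_isRegularLocalRing_of_le` — every prime `P ⊇ Ī` of `R/(h)` is a SINGULAR point (`h ∈ P²`, Matsumura 14.2 via
  `not_isRegularLocalRing_localization_quotient_of_mem_sq`), for `Λ` a regular domain and `g ≠ 0`.
[folklore; cite: Matsumura1987, Thm. 16.2 (i), Thm. 14.2] [cite: StacksProject, Tag 0BIQ]
-/

-- single-problem summit: the doubled namespace component is forced
set_option linter.dupNamespace false

noncomputable section

namespace Summit.ResolutionOfSingularities.ResolutionOfSingularities.Theorems.FInjectiveMacaulayfication.ODPCurveCentre

open MvPolynomial Literature.AlgebraicGeometry.Resolution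

universe u

variable {Λ : Type u} [CommRing Λ] (g : Λ) (cen : Fin 4 → MvPolynomial (Fin 3) Λ)

/-! ## §1 The centre ideal: variables plus a constant -/

/-- The values of the centre. [plumbing] -/
theorem cen_apply (hcen : cen = ![X 0, X 1, X 2, C g]) :
    cen 0 = X 0 ∧ cen 1 = X 1 ∧ cen 2 = X 2 ∧ cen 3 = C g := by
  subst hcen
  exact ⟨rfl, rfl, rfl, rfl⟩

/-- **`I = (T₀, T₁, T₂) + g·R`**: the centre ideal is generated by all the variables and the constant `g`. [folklore] -/
theorem span_range_cen_eq (hcen : cen = ![X 0, X 1, X 2, C g]) :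
    Ideal.span (Set.range cen) =
      Ideal.span (X '' (Set.univ : Set (Fin 3)) : Set (MvPolynomial (Fin 3) Λ)) ⊔
        (Ideal.span {g}).map (C : Λ →+* MvPolynomial (Fin 3) Λ) := by
  obtain ⟨h0, h1, h2, h3⟩ := cen_apply g cen hcen
  apply le_antisymm
  · rw [Ideal.span_le]
    rintro _ ⟨j, rfl⟩
    rcases Fin.eq_zero_or_eq_succ j with rfl | ⟨j, rfl⟩
    · rw [h0]; exact MvPolynomial.X_mem_span_X_image_sup_map_C _ _ (Set.mem_univ (0 : Fin 3))
    rcases Fin.eq_zero_or_eq_succ j with rfl | ⟨j, rfl⟩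
    · rw [show ((0 : Fin 3).succ : Fin 4) = 1 from rfl, h1]
      exact MvPolynomial.X_mem_span_X_image_sup_map_C _ _ (Set.mem_univ (1 : Fin 3))
    rcases Fin.eq_zero_or_eq_succ j with rfl | ⟨j, rfl⟩
    · rw [show ((0 : Fin 2).succ.succ : Fin 4) = 2 from rfl, h2]
      exact MvPolynomial.X_mem_span_X_image_sup_map_C _ _ (Set.mem_univ (2 : Fin 3))
    · rw [Fin.eq_zero j, show ((0 : Fin 1).succ.succ.succ : Fin 4) = 3 from rfl, h3]
      exact MvPolynomial.C_mem_span_X_image_sup_map_C _ _ (Ideal.subset_span rfl)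
  · refine sup_le (Ideal.span_mono ?_) ?_
    · rintro _ ⟨j, -, rfl⟩
      fin_cases j
      · exact ⟨0, h0⟩
      · exact ⟨1, h1⟩
      · exact ⟨2, h2⟩
    · rw [Ideal.map_span, Set.image_singleton, Ideal.span_le, Set.singleton_subset_iff]
      exact Ideal.subset_span ⟨3, h3⟩

/-- **`R/I ≃+* Λ/(g)`**, `C λ ↦ λ̄` (kill the variables: `R/((T) + gR) ≅ (Λ/(g))[T]/(T) ≅ (Λ/(g))[∅] ≅ Λ/(g)`). [folklore] -/
theorem exists_ringEquiv_quotient (hcen : cen = ![X 0, X 1, X 2, C g]) :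
    ∃ e : (MvPolynomial (Fin 3) Λ ⧸ Ideal.span (Set.range cen)) ≃+* (Λ ⧸ Ideal.span {g}),
      ∀ c : Λ, e (Ideal.Quotient.mk _ (C c)) = Ideal.Quotient.mk _ c := by
  haveI : IsEmpty {j : Fin 3 // j ∉ (Set.univ : Set (Fin 3))} := ⟨fun j => j.2 (Set.mem_univ _)⟩
  have hI := (span_range_cen_eq g cen hcen).trans (MvPolynomial.ker_quotient_comp_map_eq (Set.univ : Set (Fin 3)) (Ideal.span {g})).symm
  let e1 : (MvPolynomial (Fin 3) Λ ⧸ Ideal.span (Set.range cen)) ≃+*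
      (MvPolynomial (Fin 3) (Λ ⧸ Ideal.span {g}) ⧸ Ideal.span (X '' (Set.univ : Set (Fin 3)) : Set (MvPolynomial (Fin 3) (Λ ⧸ Ideal.span {g})))) :=
    (Ideal.quotEquivOfEq hI).trans
      (RingHom.quotientKerEquivOfSurjective (MvPolynomial.quotient_comp_map_surjective (Set.univ : Set (Fin 3)) (Ideal.span {g})))
  let e2 := (MvPolynomial.quotientSpanXEquiv (R := Λ ⧸ Ideal.span {g}) (Set.univ : Set (Fin 3))).toRingEquiv
  let e3 := (MvPolynomial.isEmptyAlgEquiv (Λ ⧸ Ideal.span {g}) {j : Fin 3 // j ∉ (Set.univ : Set (Fin 3))}).toRingEquiv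
  refine ⟨e1.trans (e2.trans e3), fun c => ?_⟩
  have h1 : e1 (Ideal.Quotient.mk _ (C c)) = Ideal.Quotient.mk _ (C (Ideal.Quotient.mk (Ideal.span {g}) c)) := by
    change ((Ideal.Quotient.mk _).comp (MvPolynomial.map (Ideal.Quotient.mk (Ideal.span {g})))) (C c) = _
    rw [RingHom.comp_apply, MvPolynomial.map_C]
  rw [RingEquiv.trans_apply, RingEquiv.trans_apply, h1]
  change e3 (MvPolynomial.quotientSpanXEquiv (R := Λ ⧸ Ideal.span {g}) (Set.univ : Set (Fin 3)) (Ideal.Quotient.mk _ (C _))) = _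
  rw [MvPolynomial.quotientSpanXEquiv_mk_C]
  change MvPolynomial.isEmptyAlgEquiv (Λ ⧸ Ideal.span {g}) _ (C _) = _
  rw [← MvPolynomial.algebraMap_eq, AlgEquiv.commutes]
  rfl

/-- `R/I` is a domain when `Λ/(g)` is. [folklore] -/
theorem isDomain_quotient (hcen : cen = ![X 0, X 1, X 2, C g]) [IsDomain (Λ ⧸ Ideal.span {g})] :
    IsDomain (MvPolynomial (Fin 3) Λ ⧸ Ideal.span (Set.range cen)) := by
  obtain ⟨e, -⟩ := exists_ringEquiv_quotient g cen hcen
  exact e.toMulEquiv.isDomain _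

/-- `R/I` is a regular ring when `Λ/(g)` is. [folklore] -/
theorem isRegularRing_quotient (hcen : cen = ![X 0, X 1, X 2, C g]) [IsRegularRing (Λ ⧸ Ideal.span {g})] :
    IsRegularRing (MvPolynomial (Fin 3) Λ ⧸ Ideal.span (Set.range cen)) := by
  obtain ⟨e, -⟩ := exists_ringEquiv_quotient g cen hcen
  exact IsRegularRing.of_ringEquiv (R := Λ ⧸ Ideal.span {g}) e.symm

/-- `I ≠ R` when `(g) ≠ Λ`. [folklore] -/
theorem span_range_cen_ne_top (hcen : cen = ![X 0, X 1, X 2, C g]) (hg : Ideal.span {g} ≠ ⊤) :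
    Ideal.span (Set.range cen) ≠ ⊤ := by
  obtain ⟨e, -⟩ := exists_ringEquiv_quotient g cen hcen
  haveI : Nontrivial (Λ ⧸ Ideal.span {g}) := Ideal.Quotient.nontrivial_iff.mpr hg
  haveI : Nontrivial (MvPolynomial (Fin 3) Λ ⧸ Ideal.span (Set.range cen)) := e.toEquiv.nontrivial
  exact Ideal.Quotient.nontrivial_iff.mp inferInstance

/-! ## §2 The centre is an `R`-sequence, hence quasi-regular -/

/-- **`T₀, T₁, T₂, C g` is a weakly regular sequence on `R = Λ[T₀, T₁, T₂]`** when `g` is a non-zero-divisor of `Λ`: distinct variables are weakly regular on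
any polynomial ring, and modulo all of them `C g` acts on `R/(T) ≅ Λ` as `g`. [folklore; cite: Matsumura1987, Thm. 16.1] -/
theorem isWeaklyRegular_cen (hcen : cen = ![X 0, X 1, X 2, C g]) (hg : IsSMulRegular Λ g) :
    RingTheory.Sequence.IsWeaklyRegular (MvPolynomial (Fin 3) Λ) (List.ofFn cen) := by
  subst hcen
  have hl : List.ofFn (![X 0, X 1, X 2, C g] : Fin 4 → MvPolynomial (Fin 3) Λ) = [X 0, X 1, X 2] ++ [C g] := rfl
  rw [hl, RingTheory.Sequence.isWeaklyRegular_append_iff]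
  constructor
  · -- the variables
    have := MvPolynomial.isWeaklyRegular_map_X (R := Λ) (τ := Fin 3) [0, 1, 2] (by decide)
    exact this
  · -- modulo the variables: `C g` acts on `R/(T₀, T₁, T₂) ≅ Λ[∅]` as the non-zero-divisor `C g`
    have hideal : (Ideal.ofList [(X 0 : MvPolynomial (Fin 3) Λ), X 1, X 2] • ⊤ :
        Submodule (MvPolynomial (Fin 3) Λ) (MvPolynomial (Fin 3) Λ)) =
          Ideal.span (X '' (Set.univ : Set (Fin 3)) : Set (MvPolynomial (Fin 3) Λ)) := by
      rw [smul_eq_mul, Ideal.mul_top, Ideal.ofList]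
      congr 1
      ext p
      simp only [Set.mem_setOf_eq, List.mem_cons, List.not_mem_nil, or_false, Set.mem_image, Set.mem_univ, true_and]
      constructor
      · rintro (rfl | rfl | rfl)
        · exact ⟨0, rfl⟩
        · exact ⟨1, rfl⟩
        · exact ⟨2, rfl⟩
      · rintro ⟨j, rfl⟩
        fin_cases j
        · exact Or.inl rfl
        · exact Or.inr (Or.inl rfl)
        · exact Or.inr (Or.inr rfl)
    rw [hideal, RingTheory.Sequence.isWeaklyRegular_singleton_iff]
    -- regularity of `C g` on the quotient RING `R/(T)`, read through `R/(T) ≅ Λ[T_∅]`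
    apply isSMulRegular_quotient_of_isLeftRegular
    let ε := MvPolynomial.quotientSpanXEquiv (R := Λ) (Set.univ : Set (Fin 3))
    have hC : IsLeftRegular (C g : MvPolynomial {j : Fin 3 // j ∉ (Set.univ : Set (Fin 3))} Λ) := by
      intro p q hpq
      ext m
      have := congrArg (coeff m) hpq
      simp only [coeff_C_mul] at this
      exact hg this
    intro a b hab
    apply ε.injective
    apply hC
    have := congrArg ε hab
    simp only [map_mul] at this
    rwa [MvPolynomial.quotientSpanXEquiv_mk_C] at this

/-- ★ **The centre `(T₀, T₁, T₂, C g)` is quasi-regular** (`g` a non-zero-divisor of `Λ`). [cite: Matsumura1987, Thm. 16.2 (i)] -/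
theorem isQuasiRegular_cen (hcen : cen = ![X 0, X 1, X 2, C g]) (hg : IsSMulRegular Λ g) : IsQuasiRegular cen :=
  isQuasiRegular_of_isWeaklyRegular cen (isWeaklyRegular_cen g cen hcen hg)

/-- In a domain a non-zero element is a non-zero-divisor (`IsSMulRegular`). [plumbing] -/
theorem isSMulRegular_of_ne_zero [IsDomain Λ] (hg : g ≠ 0) : IsSMulRegular Λ g :=
  fun _ _ h => mul_left_cancel₀ hg h

/-! ## §3 The hypersurface `h = T₀T₁ + T₂·C g` -/

variable (h : MvPolynomial (Fin 3) Λ)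

/-- `h ∈ I²`. [folklore] -/
theorem h_mem_sq (hcen : cen = ![X 0, X 1, X 2, C g]) (hh : h = X 0 * X 1 + X 2 * C g) :
    h ∈ Ideal.span (Set.range cen) ^ 2 := by
  obtain ⟨h0, h1, h2, h3⟩ := cen_apply g cen hcen
  have hm : ∀ j, cen j ∈ Ideal.span (Set.range cen) := fun j => Ideal.subset_span ⟨j, rfl⟩
  rw [hh, pow_two, ← h0, ← h1, ← h2, ← h3]
  exact Ideal.add_mem _ (Ideal.mul_mem_mul (hm 0) (hm 1)) (Ideal.mul_mem_mul (hm 2) (hm 3))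

/-- **`h` as the ODP family `x_p x_{p′} + x_q x_{q′}`** of `StrictTransformGraphType` §4, on each of the four charts `p = 0, 1, 2, 3`
(`(p, p′, q, q′) = (0,1,2,3), (1,0,2,3), (2,3,0,1), (3,2,0,1)`). [plumbing] -/
theorem h_eq_odp (hcen : cen = ![X 0, X 1, X 2, C g]) (hh : h = X 0 * X 1 + X 2 * C g) :
    h = cen 0 * cen 1 + cen 2 * cen 3 ∧ h = cen 1 * cen 0 + cen 2 * cen 3 ∧
      h = cen 2 * cen 3 + cen 0 * cen 1 ∧ h = cen 3 * cen 2 + cen 0 * cen 1 := by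
  obtain ⟨h0, h1, h2, h3⟩ := cen_apply g cen hcen
  rw [hh, h0, h1, h2, h3]
  refine ⟨rfl, by ring, by ring, by ring⟩

/-- ★ **Every point of `V(Ī) ⊂ Spec R/(h)` is singular**: for `Λ` a regular domain, `(g) ≠ Λ` proper with `g ≠ 0`, and a prime `P ⊇ Ī` of `R/(h)`, the local ring
`(R/(h))_P` is NOT regular — `0 ≠ h ∈ I² ⊆ 𝔓²` for the preimage `𝔓 ⊇ I` (Matsumura 14.2, `not_isRegularLocalRing_localization_quotient_of_mem_sq`).
[cite: Matsumura1987, Thm. 14.2] -/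
theorem not_isRegularLocalRing_of_le [IsRegularRing Λ] [IsDomain Λ] (hg0 : g ≠ 0) (hcen : cen = ![X 0, X 1, X 2, C g])
    (hh : h = X 0 * X 1 + X 2 * C g) (P : Ideal (MvPolynomial (Fin 3) Λ ⧸ Ideal.span {h})) [P.IsPrime]
    (hP : (Ideal.span (Set.range cen)).map (Ideal.Quotient.mk (Ideal.span {h})) ≤ P) :
    ¬ IsRegularLocalRing (Localization.AtPrime P) := by
  have hh0 : h ≠ 0 := by
    have hev : MvPolynomial.eval ![(0 : Λ), 0, 1] h = g := by
      rw [hh]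
      simp only [map_add, map_mul, eval_X, eval_C, Matrix.cons_val_zero, Matrix.cons_val_one]
      simp [Matrix.cons_val]
    intro h0
    rw [h0, map_zero] at hev
    exact hg0 hev.symm
  refine not_isRegularLocalRing_localization_quotient_of_mem_sq hh0 P ?_
  have hle : Ideal.span (Set.range cen) ≤ P.comap (Ideal.Quotient.mk (Ideal.span {h})) := by
    rw [← Ideal.map_le_iff_le_comap]; exact hP
  exact Ideal.pow_right_mono hle 2 (h_mem_sq g cen h hcen hh)

end Summit.ResolutionOfSingularities.ResolutionOfSingularities.Theorems.FInjectiveMacaulayfication.ODPCurveCentre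

end
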